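import Mathlib

/-!
# Passing nonnegativity of an iterated quadratic form to a bounded pointwise limit kernel
(crux `QuarksAsStableAction.StableActionBridge`, item stmt-QuantumFields-9737, line `Sketch`;
registered sub-goal `quadForm_nonneg_of_tendsto`)

For a finite measure `μ` on `X`, a bounded measurable test function `Ψ : X → ℂ` and a real
kernel `K : X → X → ℝ` consider the iterated quadratic form
`Q(K) := ∫ u, ∫ u', conj (Ψ u) * K u u' * Ψ u' ∂μ ∂μ`.
If `K_N → Klim` pointwise with a uniform bound `|K_N| ≤ M`, then `Q(K_N) → Q(Klim)`:
the integrand is dominated by the constant `C * M * C` (with `‖Ψ‖ ≤ C`), so dominated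
convergence applies first to the inner integral (for every fixed `u`) and then, with the
constant bound `C * M * C * μ.real univ` on the inner integrals, to the outer one. The set
`{z : ℂ | 0 ≤ z.re ∧ z.im = 0}` is closed, so "`Re Q ≥ 0` and `Im Q = 0`" passes from every
`K_N` to `Klim`. This is the limiting step that transports positivity of the quadratic form
from the partial sums of the exponential series of the Wilson gauge transfer kernel to the
kernel itself.

Mathlib only (`MeasureTheory.tendsto_integral_of_dominated_convergence`,
`MeasureTheory.norm_integral_le_of_norm_le_const`,
`MeasureTheory.StronglyMeasurable.integral_prod_right'`, `ge_of_tendsto'`,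
`tendsto_nhds_unique`).
-/

open MeasureTheory Filter
open scoped Topology

namespace Summit.QuantumFields.QCD.Cruxes.StableActionBridge.Sketch

/-- **Nonnegativity of the iterated quadratic form passes to bounded pointwise limits.**
Let `μ` be a finite measure on `X`, `Ψ : X → ℂ` bounded and measurable, `K N : X → X → ℝ`
jointly measurable kernels with `|K N u u'| ≤ M` converging pointwise to a jointly measurable
kernel `Klim`. If every iterated quadratic form
`∫ u, ∫ u', conj (Ψ u) * K N u u' * Ψ u' ∂μ ∂μ` has nonnegative real part and zero imaginary
part, then so does the one of `Klim` (dominated convergence twice, then closedness of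
`{z | 0 ≤ z.re ∧ z.im = 0}`). [folklore] -/
theorem quadForm_nonneg_of_tendsto : ∀ (X : Type) [MeasurableSpace X] (μ : Measure X) [IsFiniteMeasure μ] (K : ℕ → X → X → ℝ) (Klim : X → X → ℝ) (Ψ : X → ℂ) (M : ℝ), (∀ N u u', |K N u u'| ≤ M) → (∀ N, Measurable (Function.uncurry (K N))) → Measurable (Function.uncurry Klim) → (∀ u u', Tendsto (fun N => K N u u') atTop (𝓝 (Klim u u'))) → (∃ C : ℝ, ∀ u, ‖Ψ u‖ ≤ C) → Measurable Ψ → (∀ N, 0 ≤ (∫ u, ∫ u', (starRingEnd ℂ) (Ψ u) * ((K N u u' : ℝ) : ℂ) * Ψ u' ∂μ ∂μ).re ∧ (∫ u, ∫ u', (starRingEnd ℂ) (Ψ u) * ((K N u u' : ℝ) : ℂ) * Ψ u' ∂μ ∂μ).im = 0) → 0 ≤ (∫ u, ∫ u', (starRingEnd ℂ) (Ψ u) * ((Klim u u' : ℝ) : ℂ) * Ψ u' ∂μ ∂μ).re ∧ (∫ u, ∫ u', (starRingEnd ℂ) (Ψ u) * ((Klim u u' : ℝ) : ℂ) * Ψ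 u' ∂μ ∂μ).im = 0 := by
  intro X _ μ _ K Klim Ψ M hKb hK _ hlim hΨb hΨ hN
  obtain ⟨C, hC⟩ := hΨb
  -- nonnegative versions of the two bounds (`X` may be empty, so `C`, `M` need not be `≥ 0`)
  set C' : ℝ := max C 0
  set M' : ℝ := max M 0
  have hC' : ∀ u, ‖Ψ u‖ ≤ C' := fun u => (hC u).trans (le_max_left _ _)
  have hC'0 : 0 ≤ C' := le_max_right _ _
  have hM'0 : 0 ≤ M' := le_max_right _ _
  -- uniform pointwise bound on the integrands
  have hbound : ∀ N u u',
      ‖(starRingEnd ℂ) (Ψ u) * ((K N u u' : ℝ) : ℂ) * Ψ u'‖ ≤ C' * M' * C' := by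
    intro N u u'
    rw [norm_mul, norm_mul, Complex.norm_conj, Complex.norm_real, Real.norm_eq_abs]
    exact mul_le_mul (mul_le_mul (hC' u) ((hKb N u u').trans (le_max_left _ _))
      (abs_nonneg _) hC'0) (hC' u') (norm_nonneg _) (mul_nonneg hC'0 hM'0)
  -- measurability of the sections `u' ↦ conj (Ψ u) * k u u' * Ψ u'`
  have hsec : ∀ k : X → X → ℝ, Measurable (Function.uncurry k) → ∀ u,
      Measurable fun u' => (starRingEnd ℂ) (Ψ u) * ((k u u' : ℝ) : ℂ) * Ψ u' := by
    intro k hk u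
    exact (measurable_const.mul (Complex.measurable_ofReal.comp hk.of_uncurry_left)).mul hΨ
  -- strong measurability of the inner integrals `u ↦ ∫ u', conj (Ψ u) * k u u' * Ψ u' ∂μ`
  have hint : ∀ k : X → X → ℝ, Measurable (Function.uncurry k) →
      StronglyMeasurable fun u => ∫ u', (starRingEnd ℂ) (Ψ u) * ((k u u' : ℝ) : ℂ) * Ψ u' ∂μ := by
    intro k hk
    have hj : Measurable fun p : X × X =>
        (starRingEnd ℂ) (Ψ p.1) * ((k p.1 p.2 : ℝ) : ℂ) * Ψ p.2 :=
      ((Complex.continuous_conj.measurable.comp (hΨ.comp measurable_fst)).mul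
        (Complex.measurable_ofReal.comp hk)).mul (hΨ.comp measurable_snd)
    exact hj.stronglyMeasurable.integral_prod_right'
  -- pointwise convergence of the integrands
  have hpt : ∀ u u', Tendsto (fun N => (starRingEnd ℂ) (Ψ u) * ((K N u u' : ℝ) : ℂ) * Ψ u')
      atTop (𝓝 ((starRingEnd ℂ) (Ψ u) * ((Klim u u' : ℝ) : ℂ) * Ψ u')) := by
    intro u u'
    have h : Tendsto (fun N => ((K N u u' : ℝ) : ℂ)) atTop (𝓝 ((Klim u u' : ℝ) : ℂ)) :=
      (Complex.continuous_ofReal.tendsto _).comp (hlim u u')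
    exact (h.const_mul _).mul_const _
  -- inner dominated convergence, for every fixed `u`
  have hinner : ∀ u,
      Tendsto (fun N => ∫ u', (starRingEnd ℂ) (Ψ u) * ((K N u u' : ℝ) : ℂ) * Ψ u' ∂μ) atTop
        (𝓝 (∫ u', (starRingEnd ℂ) (Ψ u) * ((Klim u u' : ℝ) : ℂ) * Ψ u' ∂μ)) := by
    intro u
    exact tendsto_integral_of_dominated_convergence (fun _ => C' * M' * C')
      (fun N => (hsec (K N) (hK N) u).aestronglyMeasurable) (integrable_const _)
      (fun N => ae_of_all _ fun u' => hbound N u u') (ae_of_all _ fun u' => hpt u u')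
  -- outer dominated convergence
  have houter :
      Tendsto (fun N => ∫ u, ∫ u', (starRingEnd ℂ) (Ψ u) * ((K N u u' : ℝ) : ℂ) * Ψ u' ∂μ ∂μ)
        atTop (𝓝 (∫ u, ∫ u', (starRingEnd ℂ) (Ψ u) * ((Klim u u' : ℝ) : ℂ) * Ψ u' ∂μ ∂μ)) := by
    refine tendsto_integral_of_dominated_convergence (fun _ => C' * M' * C' * μ.real Set.univ)
      (fun N => (hint (K N) (hK N)).aestronglyMeasurable) (integrable_const _)
      (fun N => ae_of_all _ fun u => ?_) (ae_of_all _ fun u => hinner u)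
    exact norm_integral_le_of_norm_le_const (ae_of_all _ fun u' => hbound N u u')
  -- the closed conditions `0 ≤ re`, `im = 0` pass to the limit
  refine ⟨ge_of_tendsto' ((Complex.continuous_re.tendsto _).comp houter) fun N => (hN N).1, ?_⟩
  exact tendsto_nhds_unique ((Complex.continuous_im.tendsto _).comp houter)
    (tendsto_const_nhds.congr fun N => ((hN N).2).symm)

end Summit.QuantumFields.QCD.Cruxes.StableActionBridge.Sketch
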